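import Summits.ABC.ABC.Theses.IsogenyGlueCongruence
import Summits.ABC.ABC.Theorems.IsogenyGlueCongruenceSemistableHeightPolyBound
import Literature.NumberTheory.EllipticCurves.PastenHeightBounds
import Literature.NumberTheory.EllipticCurves.PastenValuationProduct
import Literature.NumberTheory.EllipticCurves.ShafarevichGoodReductionProofs
import Literature.NumberTheory.EllipticCurves.ModularityVersionApProofs
import Literature.NumberTheory.EllipticCurves.ModularCurveNeronLatticeProofs
import Literature.NumberTheory.EllipticCurves.SzpiroOfAbcProofs
import Literature.NumberTheory.DiophantineGeometry.FaltingsHeight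
import Literature.NumberTheory.DiophantineGeometry.FaltingsHeightProofs
import HarnessLib

/-!
# Crux A `DegreePrimesPolyBounded` (stmt-ABC-2045), line `Sketch` — stub `stub_discValuation`

The stub asks for a crude POLYNOMIAL Szpiro bound for semistable curves:
`v_p(Δ_min(W)) = (W.minimalDiscriminantNorm ℤ).factorization p ≤ C · N_W^κ` for every semistable
globally minimal elliptic `W/ℚ`, with absolute `κ, C`.  This is known only through modularity
(Murty–Pasten 2013; Pasten 2024, Thms 1.9 / 7.5), and neither of the two printed inputs is a
theorem of the tree, so the stub is NOT closed here.  This file records the complete derivation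
of the stub signature from ONE named fact, in two independent ways:

* `stub_discValuation_of_pasten2024_height_lt` — from
  `Literature.NumberTheory.EllipticCurves.ModularForms.pasten2024_height_lt` (Pasten 2024,
  Thm 1.9: `h(E) < (1/48 + ε) N log N` for semistable `E`, `N ≥ N₀(ε)`), through the PROVED
  Lemma 18.1 of Pasten (`WeierstrassCurve.log_minimalDiscriminantNorm_lt_faltingsHeight_holds`:
  `log|Δ_min| < 12 h(E) + 16`), the PROVED uniformisation theorem
  (`exists_isNeronLatticeOf_holds`, supplying the Néron lattice demanded by the rendering of
  Thm 1.9), `h(E/ℚ) = neronLatticeHeight L` (`faltingsHeight_eq_neronLatticeHeight`), and the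
  PROVED theorem of Shafarevich (`shafarevich_finite_goodReductionOutside_holds`) with the model
  invariance `faltingsHeight_smul` below the threshold `N₀`;
* `stub_discValuation_of_pasten_thm_7_5` — from
  `Literature.NumberTheory.EllipticCurves.pasten_thm_7_5` (Pasten 2024, Thm 7.5, classical
  modular approach: `log|Δ_E| < (1/4 + ε) N log N` for `N ≥ N₀(ε)`, every `E/ℚ`), with
  Shafarevich and `minimalDiscriminantNorm_smul_rat` below the threshold.

The last step is the elementary `v_p(n) ≤ log n / log 2` (`factorization_le_log_div_log_two`).
Also recorded: the route's support item `SemistableHeightPolyBound` (stmt-ABC-13918, a bound for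
the STABLE height `h_F`) gives the stub once `h(E/ℚ) ≤ h_F(E) + O(1)` for semistable minimal `W`
(`𝔇 = Δ_min`, Silverman 1986 §2) is available — that comparison is not in the tree, so this third
form (`stub_discValuation_of_semistableHeightPolyBound`) carries it as an explicit hypothesis.
-/

-- `Summit.ABC.ABC` is the mandated summit-side namespace (CONVENTIONS §2); the duplicate is
-- deliberate.
set_option linter.dupNamespace false

noncomputable section

open scoped Classical
open WeierstrassCurve NumberField IsDedekindDomain
open Literature.NumberTheory.EllipticCurves.ModularForms
open Summit.ABC.ABC.Theses.IsogenyGlueCongruence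

namespace Summit.ABC.ABC.Theorems.DegreePrimesPolyBounded

/-! ### Elementary bookkeeping -/

/-- `v_p(n) ≤ log n / log 2` for all naturals `n, p` (`2^{v_p(n)} ≤ p^{v_p(n)} ≤ n` for `p` prime
and `n ≠ 0`; both sides vanish or the left side does otherwise). [folklore] -/
theorem factorization_le_log_div_log_two (n p : ℕ) :
    ((n.factorization p : ℕ) : ℝ) ≤ Real.log n / Real.log 2 := by
  have hlog2 : 0 < Real.log 2 := Real.log_pos one_lt_two
  have h0 : (0 : ℝ) ≤ Real.log n / Real.log 2 :=
    div_nonneg (Real.log_natCast_nonneg n) hlog2.le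
  rcases eq_or_ne n 0 with rfl | hn
  · simp
  by_cases hp : p.Prime
  · have h2pow : 2 ^ n.factorization p ≤ n :=
      le_trans (Nat.pow_le_pow_left hp.two_le _) (Nat.ordProj_le p hn)
    have h2pow' : ((2 : ℝ) ^ n.factorization p) ≤ (n : ℝ) := by exact_mod_cast h2pow
    have hlog := Real.log_le_log (by positivity) h2pow'
    rw [Real.log_pow] at hlog
    rw [le_div_iff₀ hlog2]
    exact hlog
  · rw [Nat.factorization_eq_zero_of_not_prime n hp]
    simpa using h0

/-- From `log n ≤ c · N²` (`N ≥ 1`) to `v_p(n) ≤ (max c 0 / log 2) · N ^ (2 : ℝ)` for every `p`.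
[folklore] -/
theorem factorization_le_of_log_le {n N : ℕ} {c : ℝ} (hN : 1 ≤ N)
    (h : Real.log n ≤ c * (N : ℝ) ^ 2) (p : ℕ) :
    ((n.factorization p : ℕ) : ℝ) ≤ max c 0 / Real.log 2 * (N : ℝ) ^ (2 : ℝ) := by
  have hlog2 : 0 < Real.log 2 := Real.log_pos one_lt_two
  have hN1 : (1 : ℝ) ≤ (N : ℝ) := by exact_mod_cast hN
  have hsq0 : (0 : ℝ) ≤ (N : ℝ) ^ 2 := by positivity
  rw [Real.rpow_two]
  calc ((n.factorization p : ℕ) : ℝ) ≤ Real.log n / Real.log 2 :=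
        factorization_le_log_div_log_two n p
    _ ≤ c * (N : ℝ) ^ 2 / Real.log 2 := div_le_div_of_nonneg_right h hlog2.le
    _ ≤ max c 0 * (N : ℝ) ^ 2 / Real.log 2 :=
        div_le_div_of_nonneg_right (mul_le_mul_of_nonneg_right (le_max_left _ _) hsq0) hlog2.le
    _ = max c 0 / Real.log 2 * (N : ℝ) ^ 2 := by ring

/-! ### Below a conductor threshold: Shafarevich -/

/-- **Bounded conductor ⇒ finitely many `ℚ`-isomorphism classes** (Shafarevich, Silverman *AEC*
Thm. IX.6.1, PROVED in the tree as `shafarevich_finite_goodReductionOutside_holds`): for every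
`N₀` there is a finite set `F` of Weierstrass models such that every elliptic `W/ℚ` with
`N_W < N₀` is `ℚ`-isomorphic to a member of `F` (`p ∣ N_W ⇔` bad reduction at `p`,
`dvd_conductorNorm_iff`). [cite: SilvermanAEC2009, Thm. IX.6.1] -/
theorem exists_finset_of_conductorNorm_lt (N₀ : ℕ) :
    ∃ F : Finset (WeierstrassCurve ℚ), ∀ (W : WeierstrassCurve ℚ) [W.IsElliptic],
      W.conductorNorm ℤ < N₀ → ∃ C : VariableChange ℚ, C • W ∈ F := by
  set f : HeightOneSpectrum (𝓞 ℚ) → ℕ :=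
    fun v => ((Rat.HeightOneSpectrum.primesEquiv v : Nat.Primes) : ℕ) with hf_def
  set S : Set (HeightOneSpectrum (𝓞 ℚ)) := f ⁻¹' Set.Iio N₀ with hS_def
  have hinj : Function.Injective f :=
    Subtype.val_injective.comp (Rat.HeightOneSpectrum.primesEquiv).injective
  have hS : S.Finite := (Set.finite_Iio N₀).preimage hinj.injOn
  obtain ⟨F, hF⟩ := shafarevich_finite_goodReductionOutside_holds ℚ S hS
  refine ⟨F, fun W _ hN => hF W ?_⟩
  intro v hv
  have hv' : ¬ W.HasGoodReductionAt v := hv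
  have hdvd : f v ∣ W.conductorNorm ℤ := (W.dvd_conductorNorm_iff v).2 hv'
  have hpos : 0 < W.conductorNorm ℤ := conductorNorm_pos_holds W
  show f v < N₀
  exact lt_of_le_of_lt (Nat.le_of_dvd hpos hdvd) hN

/-- **Bounded conductor ⇒ bounded Faltings height `h(E/ℚ)`**: Shafarevich
(`exists_finset_of_conductorNorm_lt`) and the model invariance of `h(E/ℚ)`
(`faltingsHeight_smul`). [cite: SilvermanAEC2009, Thm. IX.6.1] -/
theorem exists_faltingsHeight_le_of_conductorNorm_lt (N₀ : ℕ) :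
    ∃ B : ℝ, ∀ (W : WeierstrassCurve ℚ) [W.IsElliptic], W.conductorNorm ℤ < N₀ →
      W.faltingsHeight ≤ B := by
  obtain ⟨F, hF⟩ := exists_finset_of_conductorNorm_lt N₀
  refine ⟨∑ V ∈ F, |V.faltingsHeight|, fun W _ hN => ?_⟩
  obtain ⟨C, hC⟩ := hF W hN
  calc W.faltingsHeight = (C • W).faltingsHeight := (faltingsHeight_smul W C).symm
    _ ≤ |(C • W).faltingsHeight| := le_abs_self _
    _ ≤ ∑ V ∈ F, |V.faltingsHeight| :=
        Finset.single_le_sum (fun V _ => abs_nonneg (V.faltingsHeight)) hC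

/-- **Bounded conductor ⇒ bounded minimal discriminant**: Shafarevich
(`exists_finset_of_conductorNorm_lt`) and the model invariance of `|Δ_min|`
(`minimalDiscriminantNorm_smul_rat`). [cite: SilvermanAEC2009, Thm. IX.6.1] -/
theorem exists_minimalDiscriminantNorm_le_of_conductorNorm_lt (N₀ : ℕ) :
    ∃ B : ℕ, ∀ (W : WeierstrassCurve ℚ) [W.IsElliptic], W.conductorNorm ℤ < N₀ →
      W.minimalDiscriminantNorm ℤ ≤ B := by
  obtain ⟨F, hF⟩ := exists_finset_of_conductorNorm_lt N₀
  refine ⟨∑ V ∈ F, V.minimalDiscriminantNorm ℤ, fun W _ hN => ?_⟩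
  obtain ⟨C, hC⟩ := hF W hN
  calc W.minimalDiscriminantNorm ℤ = (C • W).minimalDiscriminantNorm ℤ :=
        (minimalDiscriminantNorm_smul_rat W C).symm
    _ ≤ ∑ V ∈ F, V.minimalDiscriminantNorm ℤ :=
        Finset.single_le_sum (f := fun V : WeierstrassCurve ℚ => V.minimalDiscriminantNorm ℤ)
          (fun V _ => Nat.zero_le _) hC

/-! ### Silverman / Pasten Lemma 18.1 over `ℚ` -/

/-- **`log|Δ_min| < 12 h(E/ℚ) + 16`** for every elliptic `W/ℚ` (Pasten 2024, Lemma 18.1 with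
`L = ℚ`, PROVED in the tree: `log_minimalDiscriminantNorm_lt_faltingsHeight_holds`, read on
`minimalDiscriminantNorm ℤ` through `minimalDiscriminantNorm_ringOfIntegers_rat_holds`).
[cite: PastenShimura2024, Lemma 18.1] -/
theorem log_minimalDiscriminantNorm_int_lt_faltingsHeight (W : WeierstrassCurve ℚ) [W.IsElliptic] :
    Real.log (W.minimalDiscriminantNorm ℤ) < 12 * W.faltingsHeight + 16 := by
  have h := log_minimalDiscriminantNorm_lt_faltingsHeight_holds W
  have h1 : W.minimalDiscriminantNorm (𝓞 ℚ) = W.minimalDiscriminantNorm ℤ :=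
    minimalDiscriminantNorm_ringOfIntegers_rat_holds W
  rw [Module.finrank_self, Nat.cast_one, inv_one, one_mul, h1] at h
  exact h

/-! ### From Pasten's Theorem 1.9 -/

/-- **`h(E/ℚ) ≤ c · N²` for semistable `E`**, from Pasten 2024 Thm 1.9 (named fact
`pasten2024_height_lt`, crude form `h(E) < (1/48 + 1) N log N ≤ (49/48) N²` for `N ≥ N₀`, the
Néron lattice from `exists_isNeronLatticeOf_holds` and `h(E/ℚ) = neronLatticeHeight L`), and
Shafarevich below `N₀` (`exists_faltingsHeight_le_of_conductorNorm_lt`). CONDITIONAL on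
`pasten2024_height_lt`. [cite: PastenShimura2024, Thm 1.9] -/
theorem exists_faltingsHeight_le_sq_of_pasten2024_height_lt (h : pasten2024_height_lt) :
    ∃ c : ℝ, ∀ (W : WeierstrassCurve ℚ) [W.IsElliptic] [W.IsGloballyMinimal]
      [NeZero (W.conductorNorm ℤ)], W.IsSemistable ℤ →
        W.faltingsHeight ≤ c * (W.conductorNorm ℤ : ℝ) ^ 2 := by
  obtain ⟨N₀, hN₀⟩ := h.semistable_crude one_pos
  obtain ⟨B, hB⟩ := exists_faltingsHeight_le_of_conductorNorm_lt N₀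
  refine ⟨max B (1 / 48 + 1), fun W _ _ _ hss => ?_⟩
  have hN1 : (1 : ℝ) ≤ (W.conductorNorm ℤ : ℝ) := by
    exact_mod_cast Nat.one_le_iff_ne_zero.2 (NeZero.ne _)
  have hc0 : (0 : ℝ) ≤ max B (1 / 48 + 1) := le_trans (by norm_num) (le_max_right _ _)
  have hsq : (1 : ℝ) ≤ (W.conductorNorm ℤ : ℝ) ^ 2 := by nlinarith
  by_cases hN : N₀ ≤ W.conductorNorm ℤ
  · obtain ⟨L, hL⟩ := exists_isNeronLatticeOf_holds (W.baseChange ℂ)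
    have hlt := hN₀ W L hL hss hN
    have hlog : Real.log (W.conductorNorm ℤ : ℝ) ≤ (W.conductorNorm ℤ : ℝ) :=
      (Real.log_le_sub_one_of_pos (by linarith)).trans (by linarith)
    have h48 : (0 : ℝ) ≤ (1 / 48 + 1) * (W.conductorNorm ℤ : ℝ) := by positivity
    calc W.faltingsHeight = neronLatticeHeight L :=
          Summit.ABC.ABC.Theorems.faltingsHeight_eq_neronLatticeHeight W hL
      _ ≤ (1 / 48 + 1) * (W.conductorNorm ℤ : ℝ) * Real.log (W.conductorNorm ℤ) := hlt.le
      _ ≤ (1 / 48 + 1) * (W.conductorNorm ℤ : ℝ) * (W.conductorNorm ℤ : ℝ) :=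
          mul_le_mul_of_nonneg_left hlog h48
      _ = (1 / 48 + 1) * (W.conductorNorm ℤ : ℝ) ^ 2 := by ring
      _ ≤ max B (1 / 48 + 1) * (W.conductorNorm ℤ : ℝ) ^ 2 :=
          mul_le_mul_of_nonneg_right (le_max_right _ _) (by positivity)
  · have hlt : W.conductorNorm ℤ < N₀ := lt_of_not_ge hN
    calc W.faltingsHeight ≤ B := hB W hlt
      _ ≤ max B (1 / 48 + 1) := le_max_left _ _
      _ = max B (1 / 48 + 1) * 1 := (mul_one _).symm
      _ ≤ max B (1 / 48 + 1) * (W.conductorNorm ℤ : ℝ) ^ 2 := mul_le_mul_of_nonneg_left hsq hc0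

/-- **`log|Δ_min| ≤ c · N²` for semistable `E`** from a quadratic bound for `h(E/ℚ)` and
`log|Δ_min| < 12 h + 16`. [cite: PastenShimura2024, §3 (3.1)] -/
theorem exists_log_minimalDiscriminantNorm_le_sq_of_faltingsHeight_le {c : ℝ}
    (hc : ∀ (W : WeierstrassCurve ℚ) [W.IsElliptic] [W.IsGloballyMinimal]
      [NeZero (W.conductorNorm ℤ)], W.IsSemistable ℤ →
        W.faltingsHeight ≤ c * (W.conductorNorm ℤ : ℝ) ^ 2) :
    ∀ (W : WeierstrassCurve ℚ) [W.IsElliptic] [W.IsGloballyMinimal]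
      [NeZero (W.conductorNorm ℤ)], W.IsSemistable ℤ →
        Real.log (W.minimalDiscriminantNorm ℤ) ≤ (12 * c + 16) * (W.conductorNorm ℤ : ℝ) ^ 2 := by
  intro W _ _ _ hss
  have hN1 : (1 : ℝ) ≤ (W.conductorNorm ℤ : ℝ) := by
    exact_mod_cast Nat.one_le_iff_ne_zero.2 (NeZero.ne _)
  have hsq : (1 : ℝ) ≤ (W.conductorNorm ℤ : ℝ) ^ 2 := by nlinarith
  have h1 := log_minimalDiscriminantNorm_int_lt_faltingsHeight W
  have h2 : 12 * W.faltingsHeight ≤ 12 * (c * (W.conductorNorm ℤ : ℝ) ^ 2) :=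
    mul_le_mul_of_nonneg_left (hc W hss) (by norm_num)
  have h3 : (12 * c + 16) * (W.conductorNorm ℤ : ℝ) ^ 2 =
      12 * (c * (W.conductorNorm ℤ : ℝ) ^ 2) + 16 * (W.conductorNorm ℤ : ℝ) ^ 2 := by ring
  rw [h3]
  linarith

/-- **The stub from Pasten 2024, Thm 1.9.** `v_p(Δ_min(W)) ≤ C · N_W^κ` (with `κ = 2`) for every
semistable globally minimal elliptic `W/ℚ` and every `p`, ASSUMING the named fact
`pasten2024_height_lt` (Pasten, J. Number Theory 254 (2024), Thm 1.9; not discharged in the tree).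
All other inputs are theorems of the tree (Pasten's Lemma 18.1, uniformisation, Shafarevich).
This is exactly the registered signature of `stub_discValuation`, conditionally.
[cite: PastenShimura2024, Thm 1.9 and Lemma 18.1] -/
theorem stub_discValuation_of_pasten2024_height_lt (h : pasten2024_height_lt) :
    ∃ κ C : ℝ, ∀ (W : WeierstrassCurve ℚ) [W.IsElliptic] [W.IsGloballyMinimal]
      [NeZero (W.conductorNorm ℤ)], W.IsSemistable ℤ → ∀ p : ℕ,
        (((W.minimalDiscriminantNorm ℤ).factorization p : ℕ) : ℝ) ≤
          C * (W.conductorNorm ℤ : ℝ) ^ κ := by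
  obtain ⟨c, hc⟩ := exists_faltingsHeight_le_sq_of_pasten2024_height_lt h
  have hlog := exists_log_minimalDiscriminantNorm_le_sq_of_faltingsHeight_le hc
  exact ⟨2, max (12 * c + 16) 0 / Real.log 2, fun W _ _ _ hss p =>
    factorization_le_of_log_le NeZero.one_le (hlog W hss) p⟩

/-! ### From Pasten's Theorem 7.5 (classical modular approach) -/

/-- **`log|Δ_min| ≤ c · N²` for every `E/ℚ`**, from Pasten 2024 Thm 7.5 (named fact
`pasten_thm_7_5`: `log|Δ_E| < (1/4 + 1) N log N ≤ (5/4) N²` for `N ≥ N₀`) and Shafarevich below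
`N₀` (`exists_minimalDiscriminantNorm_le_of_conductorNorm_lt`). CONDITIONAL on `pasten_thm_7_5`.
[cite: PastenShimura2024, Thm 7.5] -/
theorem exists_log_minimalDiscriminantNorm_le_sq_of_pasten_thm_7_5
    (h : Literature.NumberTheory.EllipticCurves.pasten_thm_7_5) :
    ∃ c : ℝ, ∀ (W : WeierstrassCurve ℚ) [W.IsElliptic] [NeZero (W.conductorNorm ℤ)],
      Real.log (W.minimalDiscriminantNorm ℤ) ≤ c * (W.conductorNorm ℤ : ℝ) ^ 2 := by
  obtain ⟨N₀, hN₀⟩ := h 1 one_pos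
  obtain ⟨B, hB⟩ := exists_minimalDiscriminantNorm_le_of_conductorNorm_lt N₀
  refine ⟨max (Real.log B) (1 / 4 + 1), fun W _ _ => ?_⟩
  have hN1 : (1 : ℝ) ≤ (W.conductorNorm ℤ : ℝ) := by
    exact_mod_cast Nat.one_le_iff_ne_zero.2 (NeZero.ne _)
  have hc0 : (0 : ℝ) ≤ max (Real.log B) (1 / 4 + 1) := le_trans (by norm_num) (le_max_right _ _)
  have hsq : (1 : ℝ) ≤ (W.conductorNorm ℤ : ℝ) ^ 2 := by nlinarith
  by_cases hN : N₀ ≤ W.conductorNorm ℤ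
  · have hlt := hN₀ W hN
    have hlog : Real.log (W.conductorNorm ℤ : ℝ) ≤ (W.conductorNorm ℤ : ℝ) :=
      (Real.log_le_sub_one_of_pos (by linarith)).trans (by linarith)
    have h54 : (0 : ℝ) ≤ (1 / 4 + 1) * (W.conductorNorm ℤ : ℝ) := by positivity
    calc Real.log (W.minimalDiscriminantNorm ℤ)
          ≤ (1 / 4 + 1) * (W.conductorNorm ℤ : ℝ) * Real.log (W.conductorNorm ℤ) := hlt.le
      _ ≤ (1 / 4 + 1) * (W.conductorNorm ℤ : ℝ) * (W.conductorNorm ℤ : ℝ) :=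
          mul_le_mul_of_nonneg_left hlog h54
      _ = (1 / 4 + 1) * (W.conductorNorm ℤ : ℝ) ^ 2 := by ring
      _ ≤ max (Real.log B) (1 / 4 + 1) * (W.conductorNorm ℤ : ℝ) ^ 2 :=
          mul_le_mul_of_nonneg_right (le_max_right _ _) (by positivity)
  · have hlt : W.conductorNorm ℤ < N₀ := lt_of_not_ge hN
    have hΔB : W.minimalDiscriminantNorm ℤ ≤ B := hB W hlt
    have hlogle : Real.log (W.minimalDiscriminantNorm ℤ) ≤ Real.log B := by
      rcases Nat.eq_zero_or_pos (W.minimalDiscriminantNorm ℤ) with h0 | hpos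
      · rw [h0, Nat.cast_zero, Real.log_zero]
        exact Real.log_natCast_nonneg B
      · exact Real.log_le_log (by exact_mod_cast hpos) (by exact_mod_cast hΔB)
    calc Real.log (W.minimalDiscriminantNorm ℤ) ≤ Real.log B := hlogle
      _ ≤ max (Real.log B) (1 / 4 + 1) := le_max_left _ _
      _ = max (Real.log B) (1 / 4 + 1) * 1 := (mul_one _).symm
      _ ≤ max (Real.log B) (1 / 4 + 1) * (W.conductorNorm ℤ : ℝ) ^ 2 :=
          mul_le_mul_of_nonneg_left hsq hc0

/-- **The stub from Pasten 2024, Thm 7.5** (classical modular approach; in print it needs only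
modularity, Zagier's formula and the degree bound Thm 7.2): `v_p(Δ_min(W)) ≤ C · N_W^κ`
(`κ = 2`) for every elliptic `W/ℚ` of nonzero conductor — in particular the registered signature
of `stub_discValuation` — ASSUMING the named fact `pasten_thm_7_5` (not discharged in the tree).
[cite: PastenShimura2024, Thm 7.5] -/
theorem stub_discValuation_of_pasten_thm_7_5
    (h : Literature.NumberTheory.EllipticCurves.pasten_thm_7_5) :
    ∃ κ C : ℝ, ∀ (W : WeierstrassCurve ℚ) [W.IsElliptic] [W.IsGloballyMinimal]
      [NeZero (W.conductorNorm ℤ)], W.IsSemistable ℤ → ∀ p : ℕ,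
        (((W.minimalDiscriminantNorm ℤ).factorization p : ℕ) : ℝ) ≤
          C * (W.conductorNorm ℤ : ℝ) ^ κ := by
  obtain ⟨c, hc⟩ := exists_log_minimalDiscriminantNorm_le_sq_of_pasten_thm_7_5 h
  exact ⟨2, max c 0 / Real.log 2, fun W _ _ _ _ p =>
    factorization_le_of_log_le NeZero.one_le (hc W) p⟩

/-! ### From the route's support item `SemistableHeightPolyBound` -/

/-- **The stub from the support item `SemistableHeightPolyBound` (stmt-ABC-13918)** — which bounds
the STABLE height `h_F(E) ≤ c N²` — together with the comparison `h(E/ℚ) ≤ h_F(E) + A` for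
semistable globally minimal `W` (Silverman 1986, §2: `𝔇 = Δ_{E/K}` for semistable `E`, so the two
heights agree; NOT in the tree, hence an explicit hypothesis `hcmp` here, not a named fact).
[cite: Silverman1986, §2 (p. 257)] -/
theorem stub_discValuation_of_semistableHeightPolyBound (hH : SemistableHeightPolyBound) {A : ℝ}
    (hcmp : ∀ (W : WeierstrassCurve ℚ) [W.IsElliptic] [W.IsGloballyMinimal], W.IsSemistable ℤ →
      W.faltingsHeight ≤ W.stableFaltingsHeight + A) :
    ∃ κ C : ℝ, ∀ (W : WeierstrassCurve ℚ) [W.IsElliptic] [W.IsGloballyMinimal]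
      [NeZero (W.conductorNorm ℤ)], W.IsSemistable ℤ → ∀ p : ℕ,
        (((W.minimalDiscriminantNorm ℤ).factorization p : ℕ) : ℝ) ≤
          C * (W.conductorNorm ℤ : ℝ) ^ κ := by
  obtain ⟨c, hc⟩ := hH
  have hc' : ∀ (W : WeierstrassCurve ℚ) [W.IsElliptic] [W.IsGloballyMinimal]
      [NeZero (W.conductorNorm ℤ)], W.IsSemistable ℤ →
        W.faltingsHeight ≤ (c + max A 0) * (W.conductorNorm ℤ : ℝ) ^ 2 := by
    intro W _ _ _ hss
    have hN1 : (1 : ℝ) ≤ (W.conductorNorm ℤ : ℝ) := by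
      exact_mod_cast Nat.one_le_iff_ne_zero.2 (NeZero.ne _)
    have hsq : (1 : ℝ) ≤ (W.conductorNorm ℤ : ℝ) ^ 2 := by nlinarith
    have h1 := hcmp W hss
    have h2 := hc W hss
    have hA : A ≤ max A 0 * (W.conductorNorm ℤ : ℝ) ^ 2 :=
      (le_max_left A 0).trans (le_mul_of_one_le_right (le_max_right A 0) hsq)
    calc W.faltingsHeight ≤ W.stableFaltingsHeight + A := h1
      _ ≤ c * (W.conductorNorm ℤ : ℝ) ^ 2 + max A 0 * (W.conductorNorm ℤ : ℝ) ^ 2 :=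
          add_le_add h2 hA
      _ = (c + max A 0) * (W.conductorNorm ℤ : ℝ) ^ 2 := by ring
  have hlog := exists_log_minimalDiscriminantNorm_le_sq_of_faltingsHeight_le hc'
  exact ⟨2, max (12 * (c + max A 0) + 16) 0 / Real.log 2, fun W _ _ _ hss p =>
    factorization_le_of_log_le NeZero.one_le (hlog W hss) p⟩

end Summit.ABC.ABC.Theorems.DegreePrimesPolyBounded

end
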